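import Mathlib
import Literature.MathematicalPhysics.StatisticalMechanics.HaggStacking
import Summits.AtomisticToContinuum.Crystallization.Theses.MinMeanCycleStackingLock
import Summits.AtomisticToContinuum.Crystallization.Theorems.HullExactificationCascadeHcpLandscapeGapStubDominatedRegistrySelectsHcp

/-!
# Crux `PeierlsKarpStability` (route MinMeanCycleStackingLock, item stmt-AtomisticToContinuum-12018),
# line `birth` — stub `stub_le_haggStackingEnergy` (the liminf bookkeeping)

For couplings `J` with `Σ k|J_k| < ∞`, a linear finite-volume lower bound `n·e ≤ H_n(J,s) + C` (all
`n`) forces `e ≤ haggStackingEnergy J s = liminf_n H_n(J,s)/n`.  Content: `H_n/n` is bounded by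
`Σ k|J_k|` in absolute value (landed `HcpLandscapeGapBirth.abs_haggEnergy_div_le`, so the `liminf` in the
conditionally complete lattice `ℝ` is not a junk value), and `H_n/n ≥ e − C/n → e`; monotonicity of
`liminf` (`Filter.liminf_le_liminf`).  This is the same bookkeeping that proved stub (S)
`stub_dominatedRegistrySelectsHcp` of crux stmt-12087 (there with `e = Σ_{even} J_k`, `C = Σ k|J_k|`),
isolated as the registered stub of crux stmt-12018.  All `[folklore]`.
-/

namespace Summit.AtomisticToContinuum.Crystallization.Theorems.PeierlsKarpStabilityBirth

open Filter Topology
open Literature.MathematicalPhysics.StatisticalMechanics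

/-- **Liminf bookkeeping for the stacking energy density**: if `Σ k|J_k| < ∞` and
`n·e ≤ H_n(J,s) + C` for every `n`, then `e ≤ haggStackingEnergy J s`. [folklore] -/
theorem le_haggStackingEnergy_of_linear_bound {J : ℕ → ℝ} {s : ℤ → ℤ} {e C : ℝ}
    (hsum : Summable (fun k : ℕ => (k : ℝ) * |J k|))
    (hlin : ∀ n : ℕ, (n : ℝ) * e ≤ haggEnergy n J s + C) :
    e ≤ haggStackingEnergy J s := by
  rw [haggStackingEnergy]
  have hv : Tendsto (fun n : ℕ => e - C / n) atTop (𝓝 e) := by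
    simpa using (tendsto_const_nhds (x := e)).sub (tendsto_const_div_atTop_nhds_zero_nat C)
  have hle : ∀ᶠ n : ℕ in atTop, e - C / n ≤ haggEnergy n J s / n := by
    filter_upwards [eventually_ge_atTop 1] with n hn
    have hn' : (0 : ℝ) < n := by exact_mod_cast hn
    rw [sub_le_iff_le_add, ← add_div, le_div_iff₀ hn', mul_comm]
    exact hlin n
  have hbdd : IsBoundedUnder (· ≤ ·) atTop (fun n : ℕ => haggEnergy n J s / n) :=
    isBoundedUnder_of ⟨∑' k : ℕ, (k : ℝ) * |J k|, fun n : ℕ => (le_abs_self _).trans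
      (Summit.AtomisticToContinuum.Crystallization.Theorems.HcpLandscapeGapBirth.abs_haggEnergy_div_le
        hsum s n)⟩
  calc e = liminf (fun n : ℕ => e - C / n) atTop := hv.liminf_eq.symm
    _ ≤ liminf (fun n : ℕ => haggEnergy n J s / n) atTop :=
        liminf_le_liminf hle hv.isBoundedUnder_ge hbdd.isCoboundedUnder_ge

/-- **Stub `stub_le_haggStackingEnergy` of `Cruxes/PeierlsKarpStability/Lines/birth.lean`** (crux
stmt-AtomisticToContinuum-12018, verbatim signature): the liminf bookkeeping. [folklore] -/
theorem stub_le_haggStackingEnergy :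
    ∀ (J : ℕ → ℝ) (s : ℤ → ℤ) (e C : ℝ), Summable (fun k : ℕ => (k : ℝ) * |J k|) →
      (∀ n : ℕ, (n : ℝ) * e ≤ Literature.MathematicalPhysics.StatisticalMechanics.haggEnergy n J s + C) →
      e ≤ Literature.MathematicalPhysics.StatisticalMechanics.haggStackingEnergy J s :=
  fun _ _ _ _ hsum hlin => le_haggStackingEnergy_of_linear_bound hsum hlin

end Summit.AtomisticToContinuum.Crystallization.Theorems.PeierlsKarpStabilityBirth
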